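import Summits.CriticalPhenomena.PercolationContinuityZ3.Theorems.Transplant.GrigorchukTimesZAutGroup
import Summits.CriticalPhenomena.PercolationContinuityZ3.Theorems.Transplant.AutEndStateTypes
import HarnessLib

/-!
# `Cay(𝔊 × ℤ; a, b, c, d, z)` carries NO input of any node or route of the lane, for ANY group of graph automorphisms: every pair of chart-translating
# automorphisms has DEPENDENT translation vectors (rank ≤ 1), so no single-step / quasi-step orbit datum, no planar skeleton, no rank-two input (part IV of O19b)

builds on p205010 (kernel theorem, internal audit signed; external expert review pending) — nothing in this file uses p205010.  NEGATIVE (scope) record about the INPUTS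
of the lane's nodes on ONE graph; no percolation statement; nothing about any `@[conjecture]` (MUST-NOTs stand; `θ(p_c)` on this graph NOT proved in tree or print).
Lane `prim-bschramm`, seat `prim-bschramm-p3` gen 39 (DESIGN OWNER; `P3-NILPOTENT.md` §32.3, item O19b; GO lead g26 #8453, refuter-first).  Helper file (`--supports
stmt-CriticalPhenomena-4575 --as helper`).  Def-free, no instance, no notation; `det(k•u, v) = k·det(u, v)` is «AutEndStateTypes»' `ZWr.det2_smul_left` (imported, not restated).

CONTENT.  §9 If `β₀, β₁ ∈ Aut` translate a chart `χ : 𝔊 × ℤ → ℤ²` by `c₀, c₁`, then `det(c₀, c₁) = 0` (`det2_eq_zero_of_translations`): by «GrigorchukTimesZAutGroup»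
`exists_pow_eq_transl`, `β₀^{n₀}` and `β₁^{n₁}` are translations `L_{(1, z^{j₀})}`, `L_{(1, z^{j₁})}` of the `ℤ` factor, which commute and satisfy
`L_{(1,z^{j₀})}^{j₁} = L_{(1,z^{j₁})}^{j₀}`; reading the chart along both gives `j₁ n₀ • c₀ = j₀ n₁ • c₁`.  §10 CUSTOMERS: `IsEmpty (AutChart.OrbitDatum gzCay A)` and
`IsEmpty (AutChart.OrbitQDatum gzCay A)` for every acting group `A` (the two axis steps have `det = N² ≠ 0`); `gzCay_no_framed_steps` (frames + exact steps in two directions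
yield two translating automorphisms with `det ≠ 0` — pigeonhole on the finite type set) and `IsEmpty PlanarSkeletonFrmScaled / Frm / Neg / FrmFrom gzCay`; the covering route's
`hrank` fails for every subgroup of `Aut` with an equivariant chart.  §11 the positive contrast: a RANK-ONE translation exists (the `ℤ`-coordinate chart and `L_z`) — so the
obstruction is exactly 'rank one', the (b3) sentence of VERDICTS :439 made kernel at the level of all automorphisms.
[cite: BenjaminiSchramm1996, Conj. 4; §2 (Cayley graphs)] [cite: KozmaNitzan2024, §4 p. 16 (Lemma 8)] [cite: Grigorchuk1980, every element of 𝔊 has finite order]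
-/

noncomputable section

namespace Summit.CriticalPhenomena.PercolationContinuityZ3.Theorems.Transplant

namespace Grigorchuk

open SimpleGraph Literature.Probability.Percolation Literature.Probability.LatticeModels
open scoped Classical

/-! ### §9 Two chart-translating automorphisms have dependent translation vectors -/

/-- Powers of a translating automorphism translate by multiples. [folklore] -/
theorem chart_pow_transl (χ : GZ → Site 2) (β : gzCay ≃g gzCay) (c : Site 2) (h : ∀ w, χ (β w) = χ w + c) :
    ∀ (k : ℕ) (w : GZ), χ ((β ^ k) w) = χ w + k • c := by
  intro k
  induction k with
  | zero => intro w; rw [pow_zero, zero_smul, add_zero]; rfl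
  | succ k ih => intro w; rw [pow_succ, RelIso.mul_apply, ih (β w), h w, add_assoc, succ_nsmul']

/-- The inverse of a translating automorphism translates by the opposite vector. [folklore] -/
theorem chart_inv_transl (χ : GZ → Site 2) (β : gzCay ≃g gzCay) (c : Site 2) (h : ∀ w, χ (β w) = χ w + c) (w : GZ) : χ (β⁻¹ w) = χ w - c := by
  have h1 := h (β⁻¹ w)
  rw [RelIso.apply_inv_self] at h1
  rw [h1, add_sub_cancel_right]

/-- Reading a chart along the translations `(1, z^{p j})`, all integers `p`. [folklore] -/
theorem chart_zmul_transl (χ : GZ → Site 2) (j : ℤ) (d : Site 2) (h : ∀ w, χ (((1, Multiplicative.ofAdd j) : GZ) * w) = χ w + d) :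
    ∀ (p : ℤ) (w : GZ), χ (((1, Multiplicative.ofAdd (p * j)) : GZ) * w) = χ w + p • d := by
  have hsplit : ∀ (p : ℤ) (w : GZ), ((1, Multiplicative.ofAdd ((p + 1) * j)) : GZ) * w =
      ((1, Multiplicative.ofAdd j) : GZ) * (((1, Multiplicative.ofAdd (p * j)) : GZ) * w) := by
    intro p w
    rw [← mul_assoc]
    congr 1
    rw [Prod.mk_mul_mk, one_mul, ← ofAdd_add, add_mul, one_mul, add_comm]
  intro p
  induction p using Int.induction_on with
  | zero => intro w; rw [zero_mul, ofAdd_zero, zero_smul, add_zero]; exact congrArg χ (one_mul w)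
  | succ p ih => intro w; rw [hsplit, h, ih, add_assoc, add_smul, one_smul]
  | pred p ih =>
    intro w
    have e := hsplit (-(p : ℤ) - 1) w
    rw [sub_add_cancel] at e
    have h2 := h (((1, Multiplicative.ofAdd ((-(p : ℤ) - 1) * j)) : GZ) * w)
    rw [← e, ih] at h2
    -- `χ w + (-p) • d = χ (T w) + d`
    rw [sub_smul, one_smul, ← add_sub_assoc]
    exact eq_sub_iff_add_eq.2 h2.symm

/-- **TWO AUTOMORPHISMS OF `Cay(𝔊 × ℤ; a, b, c, d, z)` TRANSLATING A CHART HAVE DEPENDENT TRANSLATION VECTORS**: `det(c₀, c₁) = 0`.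
[cite: BenjaminiSchramm1996, §2 (Cayley graphs)] [cite: Grigorchuk1980, every element of 𝔊 has finite order] -/
theorem det2_eq_zero_of_translations (χ : GZ → Site 2) (β₀ β₁ : gzCay ≃g gzCay) (c₀ c₁ : Site 2)
    (h₀ : ∀ w, χ (β₀ w) = χ w + c₀) (h₁ : ∀ w, χ (β₁ w) = χ w + c₁) : MaxArea.det2 c₀ c₁ = 0 := by
  obtain ⟨n₀, hn₀, j₀, hβ₀⟩ := exists_pow_eq_transl β₀
  obtain ⟨n₁, hn₁, j₁, hβ₁⟩ := exists_pow_eq_transl β₁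
  -- the two `ℤ`-translations read on the chart
  have hT₀ : ∀ w, χ (((1, Multiplicative.ofAdd j₀) : GZ) * w) = χ w + n₀ • c₀ := fun w => by
    rw [← hβ₀ w]; exact chart_pow_transl χ β₀ c₀ h₀ n₀ w
  have hT₁ : ∀ w, χ (((1, Multiplicative.ofAdd j₁) : GZ) * w) = χ w + n₁ • c₁ := fun w => by
    rw [← hβ₁ w]; exact chart_pow_transl χ β₁ c₁ h₁ n₁ w
  have e₀ := chart_zmul_transl χ j₀ _ hT₀ j₁ 1
  have e₁ := chart_zmul_transl χ j₁ _ hT₁ j₀ 1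
  rw [mul_comm j₀ j₁, e₀] at e₁
  have key : j₁ • (n₀ • c₀) = j₀ • (n₁ • c₁) := add_left_cancel e₁
  by_cases hj₁ : j₁ = 0
  · -- `β₁^{n₁}` is the identity: `n₁ • c₁ = 0`
    have h0 : n₁ • c₁ = 0 := by
      have h := hT₁ 1
      rw [hj₁, ofAdd_zero, mul_one] at h
      exact (add_eq_left.1 h.symm)
    have hc₁ : c₁ = 0 := (smul_eq_zero.1 h0).resolve_left hn₁.ne'
    rw [hc₁, MaxArea.det2_zero_right]
  · have hk : (j₁ * n₀ : ℤ) ≠ 0 := mul_ne_zero hj₁ (by exact_mod_cast hn₀.ne')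
    have e2 : (j₁ * n₀ : ℤ) • c₀ = (j₀ * n₁ : ℤ) • c₁ := by
      rw [mul_smul, mul_smul, natCast_zsmul, natCast_zsmul]; exact key
    have h3 : (j₁ * n₀ : ℤ) * MaxArea.det2 c₀ c₁ = 0 := by
      rw [← ZWr.det2_smul_left, e2, ZWr.det2_smul_left, MaxArea.det2_self, mul_zero]
    exact (mul_eq_zero.1 h3).resolve_left hk

/-! ### §10 The customers: no orbit datum, no quasi-step datum, no framed chart with steps, no rank-two input -/

/-- `det(N e₀, N e₁) = N² ≠ 0` for `N ≥ 1`. [folklore] -/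
theorem det2_axis_ne_zero {N : ℕ} (hN : 1 ≤ N) :
    MaxArea.det2 (Pi.single 0 ((N : ℤ) * ((1 : ℤˣ) : ℤ))) (Pi.single 1 ((N : ℤ) * ((1 : ℤˣ) : ℤ))) ≠ 0 := by
  have hN' : (N : ℤ) ≠ 0 := by exact_mod_cast (by omega : N ≠ 0)
  simp only [MaxArea.det2, Units.val_one, mul_one, Pi.single_eq_same, Pi.single_eq_of_ne (one_ne_zero : (1 : Fin 2) ≠ 0),
    Pi.single_eq_of_ne (zero_ne_one : (0 : Fin 2) ≠ 1), mul_zero, sub_zero]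
  exact mul_ne_zero hN' hN'

section Action

variable {A : Type} [Group A] [MulAction A GZ]

/-- The automorphism through which `a` acts. [folklore] -/
theorem exists_aut_of_isActionByAut (hact : IsActionByAut gzCay A) (a : A) : ∃ α : gzCay ≃g gzCay, ∀ w, α w = a • w :=
  ⟨{ toEquiv := MulAction.toPerm a, map_rel_iff' := fun {x y} => hact a x y }, fun _ => rfl⟩

/-- **`Cay(𝔊 × ℤ; a, b, c, d, z)` carries NO single-step ORBIT DATUM for ANY acting group** (orbit theorem N3-a). [cite: BenjaminiSchramm1996, Conj. 4; §2]
[cite: KozmaNitzan2024, §4 p. 16 (Lemma 8)] -/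
theorem isEmpty_orbitDatum_gzCay : IsEmpty (AutChart.OrbitDatum gzCay A) := by
  refine ⟨fun D => ?_⟩
  obtain ⟨a, r, hr, -⟩ := D.cover 1
  obtain ⟨a₀, r₀, -, -, h₀⟩ := D.step r hr 0 1
  obtain ⟨a₁, r₁, -, -, h₁⟩ := D.step r hr 1 1
  obtain ⟨β₀, hβ₀⟩ := exists_aut_of_isActionByAut D.act a₀
  obtain ⟨β₁, hβ₁⟩ := exists_aut_of_isActionByAut D.act a₁
  have hdet := det2_eq_zero_of_translations D.chart β₀ β₁ (D.ψ a₀) (D.ψ a₁)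
    (fun w => by rw [hβ₀, D.chart_smul, add_comm]) (fun w => by rw [hβ₁, D.chart_smul, add_comm])
  rw [h₀, h₁] at hdet
  exact det2_axis_ne_zero D.one_le_N hdet

/-- **`Cay(𝔊 × ℤ; a, b, c, d, z)` carries NO QUASI-STEP ORBIT DATUM for ANY acting group** (rung Q's input). [cite: BenjaminiSchramm1996, Conj. 4; §2]
[cite: KozmaNitzan2024, §4 p. 16 (Lemma 8)] -/
theorem isEmpty_orbitQDatum_gzCay : IsEmpty (AutChart.OrbitQDatum gzCay A) := by
  refine ⟨fun D => ?_⟩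
  obtain ⟨a, r, hr, -⟩ := D.cover 1
  obtain ⟨a₀, r₀, p₀, -, -, h₀, -⟩ := D.qstep r hr 0 1
  obtain ⟨a₁, r₁, p₁, -, -, h₁, -⟩ := D.qstep r hr 1 1
  obtain ⟨β₀, hβ₀⟩ := exists_aut_of_isActionByAut D.act a₀
  obtain ⟨β₁, hβ₁⟩ := exists_aut_of_isActionByAut D.act a₁
  have hdet := det2_eq_zero_of_translations D.chart β₀ β₁ (D.ψ a₀) (D.ψ a₁)
    (fun w => by rw [hβ₀, D.chart_smul, add_comm]) (fun w => by rw [hβ₁, D.chart_smul, add_comm])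
  rw [h₀, h₁] at hdet
  exact det2_axis_ne_zero D.one_le_N hdet

end Action

/-- **Frames + exact steps in ONE axis direction yield a translating automorphism whose vector is a NON-ZERO multiple of that axis**
(pigeonhole on the finite type set along the iterated steps). [cite: BenjaminiSchramm1996, Conj. 4; §2] -/
theorem exists_axis_translation (χ : GZ → Site 2) (types : Finset GZ)
    (hframe : ∀ v : GZ, ∃ t ∈ types, ∃ α : gzCay ≃g gzCay, α t = v ∧ ∀ w, χ (α w) = χ w + (χ v - χ t)) (N : ℕ) (hN : 1 ≤ N) (i : Fin 2)
    (hstep : ∀ v : GZ, ∃ v' : GZ, gzCay.Adj v v' ∧ χ v' = χ v + Pi.single i (N : ℤ)) :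
    ∃ (β : gzCay ≃g gzCay) (m : ℤ), m ≠ 0 ∧ ∀ w, χ (β w) = χ w + Pi.single i m := by
  choose nxt _ hnxt using hstep
  -- the iterated steps from `1`
  have hit : ∀ k : ℕ, χ (nxt^[k] 1) = χ 1 + (k : ℤ) • Pi.single i (N : ℤ) := by
    intro k
    induction k with
    | zero => rw [Function.iterate_zero, id, Nat.cast_zero, zero_smul, add_zero]
    | succ k ih => rw [Function.iterate_succ_apply', hnxt, ih, Nat.cast_succ, add_smul, one_smul, add_assoc]
  choose t ht α hαt hα using hframe
  obtain ⟨k₁, k₂, hne, heq⟩ := Finite.exists_ne_map_eq_of_infinite (fun k : ℕ => (⟨t (nxt^[k] 1), ht _⟩ : ↥types))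
  have heq' : t (nxt^[k₁] 1) = t (nxt^[k₂] 1) := congrArg Subtype.val heq
  refine ⟨α (nxt^[k₂] 1) * (α (nxt^[k₁] 1))⁻¹, ((k₂ : ℤ) - k₁) * N, ?_, fun w => ?_⟩
  · exact mul_ne_zero (sub_ne_zero.2 (by exact_mod_cast hne.symm)) (by exact_mod_cast (by omega : N ≠ 0))
  · rw [RelIso.mul_apply, hα, chart_inv_transl χ _ _ (hα (nxt^[k₁] 1)), hit, hit, heq']
    ext l
    simp only [Pi.add_apply, Pi.sub_apply, Pi.smul_apply, smul_eq_mul, Pi.single_apply]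
    split_ifs <;> ring

/-- **NO FRAMED CHART WITH EXACT STEPS on `Cay(𝔊 × ℤ; a, b, c, d, z)`** (for every `N ≥ 1`): the two axis directions would give translating automorphisms with
independent vectors, against `det2_eq_zero_of_translations`. [cite: BenjaminiSchramm1996, Conj. 4; §2] -/
theorem gzCay_no_framed_steps (χ : GZ → Site 2) (types : Finset GZ)
    (hframe : ∀ v : GZ, ∃ t ∈ types, ∃ α : gzCay ≃g gzCay, α t = v ∧ ∀ w, χ (α w) = χ w + (χ v - χ t)) (N : ℕ) (hN : 1 ≤ N) :
    ¬ ∀ (v : GZ) (i : Fin 2) (σ : ℤˣ), ∃ v' : GZ, gzCay.Adj v v' ∧ χ v' = χ v + Pi.single i ((N : ℤ) * σ) := by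
  intro hstep
  have hstep' : ∀ (i : Fin 2) (v : GZ), ∃ v' : GZ, gzCay.Adj v v' ∧ χ v' = χ v + Pi.single i (N : ℤ) := fun i v => by
    simpa only [Units.val_one, mul_one] using hstep v i 1
  obtain ⟨β₀, m₀, hm₀, h₀⟩ := exists_axis_translation χ types hframe N hN 0 (hstep' 0)
  obtain ⟨β₁, m₁, hm₁, h₁⟩ := exists_axis_translation χ types hframe N hN 1 (hstep' 1)
  have hdet := det2_eq_zero_of_translations χ β₀ β₁ _ _ h₀ h₁
  simp only [MaxArea.det2, Pi.single_eq_same, Pi.single_eq_of_ne (one_ne_zero : (1 : Fin 2) ≠ 0),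
    Pi.single_eq_of_ne (zero_ne_one : (0 : Fin 2) ≠ 1), mul_zero, sub_zero] at hdet
  exact mul_ne_zero hm₀ hm₁ hdet

/-- **`Cay(𝔊 × ℤ; a, b, c, d, z)` carries NO `PlanarSkeletonFrmScaled`** (node U_s). [cite: BenjaminiSchramm1996, Conj. 4; §2] -/
theorem isEmpty_planarSkeletonFrmScaled_gzCay : IsEmpty (PlanarSkeletonFrmScaled gzCay) :=
  ⟨fun Φ => gzCay_no_framed_steps Φ.φ Φ.types Φ.frame Φ.N Φ.one_le_N Φ.step⟩

/-- **… NO `PlanarSkeletonFrm`** (node U). [cite: BenjaminiSchramm1996, Conj. 4; §2] -/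
theorem isEmpty_planarSkeletonFrm_gzCay : IsEmpty (PlanarSkeletonFrm gzCay) :=
  ⟨fun Φ => gzCay_no_framed_steps Φ.φ Φ.types Φ.frame 1 le_rfl fun v i σ => by simpa only [Nat.cast_one, one_mul] using Φ.step v i σ⟩

/-- **… NO `PlanarSkeletonNeg`** (node N1). [cite: BenjaminiSchramm1996, Conj. 4; §2] -/
theorem isEmpty_planarSkeletonNeg_gzCay : IsEmpty (PlanarSkeletonNeg gzCay) :=
  ⟨fun Φ => gzCay_no_framed_steps Φ.φ Φ.types Φ.frame 1 le_rfl fun v i σ => by simpa only [Nat.cast_one, one_mul] using Φ.step v i σ⟩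

/-- **… NO `PlanarSkeletonFrmFrom`** (node N2). [cite: BenjaminiSchramm1996, Conj. 4; §2] -/
theorem isEmpty_planarSkeletonFrmFrom_gzCay : IsEmpty (PlanarSkeletonFrmFrom gzCay) :=
  ⟨fun Φ => gzCay_no_framed_steps Φ.φ Φ.types Φ.frame 1 le_rfl fun v i σ => by simpa only [Nat.cast_one, one_mul] using Φ.step v i σ⟩

/-- **The covering route's rank-two input FAILS for every subgroup `A₀ ≤ Aut` carrying an equivariant chart** (`hrank` of `AutCyl.conj4_of_orbitDatum_fc`).
[cite: BenjaminiSchramm1996, Conj. 4; §2] [cite: MartineauSevero2019, Cor. 2.2] -/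
theorem gzCay_not_rankTwo_of_chart (A₀ : Subgroup (gzCay ≃g gzCay)) (c : A₀ →* Multiplicative (Site 2)) (χ : GZ → Site 2)
    (hχ : ∀ (a : A₀) (w : GZ), χ ((a : gzCay ≃g gzCay) w) = χ w + Multiplicative.toAdd (c a)) :
    ¬ ∃ a b : A₀, MaxArea.det2 (Multiplicative.toAdd (c a)) (Multiplicative.toAdd (c b)) ≠ 0 := by
  rintro ⟨a, b, h⟩
  exact h (det2_eq_zero_of_translations χ (a : gzCay ≃g gzCay) (b : gzCay ≃g gzCay) _ _ (hχ a) (hχ b))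

/-! ### §11 The positive contrast: a RANK-ONE translation exists -/

/-- **The `ℤ`-coordinate chart IS translated by `L_z`, by `e₀`**: rank ONE is realised on `Cay(𝔊 × ℤ; a, b, c, d, z)` — so the obstruction of §9–§10 is exactly
'rank one, not two' (VERDICTS :439 (b3)). [cite: BenjaminiSchramm1996, §2 (Cayley graphs)] -/
theorem exists_rankOne_translation :
    ∃ (χ : GZ → Site 2) (β : gzCay ≃g gzCay), ∀ w, χ (β w) = χ w + Pi.single 0 1 := by
  refine ⟨fun w : GZ => (Pi.single (0 : Fin 2) (Multiplicative.toAdd w.2) : Site 2), leftMulIso gzGens zP, fun w => ?_⟩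
  simp only [leftMulIso_apply, zP, Prod.snd_mul, toAdd_mul, toAdd_ofAdd, Pi.single_add, add_comm]

end Grigorchuk

end Summit.CriticalPhenomena.PercolationContinuityZ3.Theorems.Transplant
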